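import Mathlib
import Summits.HodgeConjecture.FermatCycles.HodgeFermatDecodingRingA

/-!
# The DECODING THEOREM in ring form — part 2: the level `3n`, the pattern cases, `thmF_of_parity` (`HodgeFermat/DecodingRing.lean`; HF-G32b)

Tree copy (part 2 of 2) of the module `HodgeFermat/DecodingRing.lean` of the sibling cell's standalone package
`run/shared/lean/pub/pub-hodgefermat/lean/HodgeFermat/` (651 lines, sha256 `e7bd7f2b6b4f0457…`), source lines 330–651 (§3 units/numerals/residues at level `3n`, §4 the four pattern cases, §5 the assembly `thmF_of_parity`, §6 consistency with THEOREM F*(3p)).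
Filed by cell `pub-hfermat`, seat prover-1 gen-2, on the COORDINATOR KEEPER RULING of 2026-08-25 (gem sweep H1: take the
off-gate kernel theorem `thmFstar` through the gate) — here its second namesake, `HodgeFermat/ThmFstarNFinal.lean:29`,
THEOREM F*(3N) at every admissible squarefree level (the first, `DecodingFinal.thmFstar` = THEOREM F* at the prime levels,
landed on 2026-08-25 as `HodgeFermatThmFstar.lean`, seat prover-1 gen-0); this file is one link of the import closure of
`ThmFstarNFinal.thmFstar` on top of that landed chain.  The source module's declarations are VERBATIM those of the cell record
`check/ThmFstarN_standalone.lean` (21 bodies, 438 871 B, sha256 ced731ec52c92191…, hub `lean check` rc 0, 222.2 s, `--axioms …ThmFstarN.thmFstarN` = [propext, Classical.choice, Quot.sound]; pub-hodgefermat `CERT.md` l.987, GATE HF-G33).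
Deviations from the source module, exhaustively: the `import` lines (tree modules `Summits.HodgeConjecture.FermatCycles.
HodgeFermat*` instead of `HodgeFermat.*`); this module docstring; the `set_option`/namespace/`open` preamble (source l.30–41) is repeated at the top because the module is split; DEDUP (the gate's `dedup.landed`, bounce of p400658): the source's consistency check `theorem thmFstar'` (l.637–647: `Decoding.thmFstar` re-derived through `thmF_of_parity`) has, by design, exactly the statement of the landed `HodgeFermat.KRFree.Decoding.thmFstar` (`HodgeFermatDecodingC.lean`) and is therefore DELETED (it is used nowhere; `parity_of_sameType` stays); one-line docstrings added (gate lint) to `coprime_three`, `isUnit_third`, `ndvd_of_coprime`, `parity_of_sameType`. The module docstring is quoted in full in part 1.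
Every other line — in particular every declaration's statement and proof — is byte-identical to the source.
HONEST FRAMING: explicit algebraic cycles for specific Hodge classes on Fermat/Delsarte varieties; residual open instances
listed; no claim on general Hodge.  (This file is arithmetic of CM types / of `(ℤ/N)ˣ`; it claims nothing about cycles.)
-/

set_option autoImplicit false

namespace HodgeFermat.KRFree.DecodingRing

open HodgeFermat.KRFree.LemmaN HodgeFermat.KRFree.LemmaEMu
open HodgeFermat.KRFree.MuEven (muEntry muFun mu_even)
open HodgeFermat.KRFree.NuOdd (nuEntry nuFun)
open HodgeFermat.KRFree.NuOddSharp (nu_odd' nu_sum_eq')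
open HodgeFermat.KRFree.ChiThree (chi3 chi3_ne_zero)
open HodgeFermat.KRFree.Decoding (ind ind_pos ind_neg ind_bd ind_True ind_False mZ dZ mU nU mU_swap mU_rot nU_swap nU_rot
  muFun_U muFun_Z1 muFun_Z3 nuFun_U nuFun_Z1 nuFun_Z3 chi3_congr mod_eq_of_chi3_eq chi3_neg sum3_U sum3_Z three_dvd p_dvd
  third_ne_of_nmod zsum_U zsum_Z1 zsum_Z3)
/-! ## 3. The level `3n`: units, numerals, residues -/

section Level

variable {n : ℕ}

/-- `3 ∤ n` iff `3` is prime to `n` -/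
lemma coprime_three (h3n : ¬ 3 ∣ n) : Nat.Coprime 3 n := (Nat.Prime.coprime_iff_not_dvd Nat.prime_three).mpr h3n

/-- an entry prime to `n` is a UNIT of `ZMod n` -/
lemma isUnit_cast {y : ℕ} (hy : Nat.Coprime y n) : IsUnit ((y : ℕ) : ZMod n) := (ZMod.isUnit_iff_coprime y n).mpr hy

/-- for `y` prime to `n` and `3 ∣ y`, `y/3` is a unit of `ZMod n` -/
lemma isUnit_third {y : ℕ} (hy : Nat.Coprime y n) (h3 : 3 ∣ y) : IsUnit (((y / 3 : ℕ)) : ZMod n) :=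
  isUnit_cast (Nat.Coprime.coprime_dvd_left (Nat.div_dvd_of_dvd h3) hy)

/-- an entry prime to `n > 1` is not divisible by `3n` -/
lemma ndvd_of_coprime (hn1 : 1 < n) {y : ℕ} (hy : Nat.Coprime y n) : ¬ 3 * n ∣ y :=
  fun h => hn1.ne' (Nat.Coprime.eq_one_of_dvd (Nat.coprime_comm.mp hy) (p_dvd h))

/-- `2` and `3` are units of `ZMod n` for `gcd(n, 6) = 1` -/
lemma units23 (h2n : ¬ 2 ∣ n) (h3n : ¬ 3 ∣ n) : IsUnit (2 : ZMod n) ∧ IsUnit (3 : ZMod n) := by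
  have u2 := isUnit_cast (n := n) ((Nat.Prime.coprime_iff_not_dvd Nat.prime_two).mpr h2n)
  have u3 := isUnit_cast (n := n) (coprime_three h3n)
  exact ⟨by exact_mod_cast u2, by exact_mod_cast u3⟩

/-- the numerals the decoding needs are non-zero in `ZMod n` for `n ≥ 11`, `n ≠ 13`, `3 ∤ n` -/
lemma numerals (hn11 : 11 ≤ n) (hn13 : n ≠ 13) (h3n : ¬ 3 ∣ n) :
    (2 : ZMod n) ≠ 0 ∧ (3 : ZMod n) ≠ 0 ∧ (4 : ZMod n) ≠ 0 ∧ (5 : ZMod n) ≠ 0 ∧ (7 : ZMod n) ≠ 0 ∧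
      (8 : ZMod n) ≠ 0 ∧ (9 : ZMod n) ≠ 0 ∧ (13 : ZMod n) ≠ 0 ∧ (15 : ZMod n) ≠ 0 := by
  have small : ∀ k : ℕ, 0 < k → k ≤ 10 → ((k : ℕ) : ZMod n) ≠ 0 := by
    intro k h0 h10 h
    rw [ZMod.natCast_eq_zero_iff] at h
    have := Nat.le_of_dvd h0 h
    omega
  have k13 : ((13 : ℕ) : ZMod n) ≠ 0 := by
    intro h
    rw [ZMod.natCast_eq_zero_iff] at h
    have := Nat.le_of_dvd (by norm_num) h
    interval_cases n <;> omega
  have k15 : ((15 : ℕ) : ZMod n) ≠ 0 := by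
    intro h
    rw [ZMod.natCast_eq_zero_iff] at h
    have := Nat.le_of_dvd (by norm_num) h
    interval_cases n <;> omega
  refine ⟨?_, ?_, ?_, ?_, ?_, ?_, ?_, ?_, ?_⟩
  · exact_mod_cast small 2 (by norm_num) (by norm_num)
  · exact_mod_cast small 3 (by norm_num) (by norm_num)
  · exact_mod_cast small 4 (by norm_num) (by norm_num)
  · exact_mod_cast small 5 (by norm_num) (by norm_num)
  · exact_mod_cast small 7 (by norm_num) (by norm_num)
  · exact_mod_cast small 8 (by norm_num) (by norm_num)
  · exact_mod_cast small 9 (by norm_num) (by norm_num)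
  · exact_mod_cast k13
  · exact_mod_cast k15

/-- CRT: disjoint mod `3n` within one class mod `3` means distinct in `ZMod n` (`gcd(3, n) = 1`) -/
lemma ne_of_nmod (h3n : ¬ 3 ∣ n) {u v : ℕ} (h3 : u % 3 = v % 3) (h : ¬ u ≡ v [MOD 3 * n]) :
    (v : ZMod n) ≠ (u : ZMod n) := by
  intro huv
  exact h ((Nat.modEq_and_modEq_iff_modEq_mul (coprime_three h3n)).mp
    ⟨h3, ((ZMod.natCast_eq_natCast_iff' v u n).mp huv).symm⟩)

/-! ## 4. The four pattern cases at level `3n` -/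

/-- (Z3, Z3) -/
theorem caseZ3Z3 (h3n : ¬ 3 ∣ n) (hn11 : 11 ≤ n) (hn13 : n ≠ 13) {a b c a' b' c' : ℕ}
    (h3a : 3 ∣ a) (h3b : 3 ∣ b) (h3c : 3 ∣ c) (h3a' : 3 ∣ a') (h3b' : 3 ∣ b') (h3c' : 3 ∣ c')
    (hs : 3 * n ∣ a + b + c) (ha : Nat.Coprime a n) (hb : Nat.Coprime b n) (hc : Nat.Coprime c n)
    (hda : ¬ a ≡ a' [MOD 3 * n]) (hdb : ¬ a ≡ b' [MOD 3 * n]) (hdc : ¬ a ≡ c' [MOD 3 * n])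
    (hE : ∀ x : ZMod n, muFun (a, b, c) (-x) - muFun (a', b', c') (-x) = muFun (a, b, c) x - muFun (a', b', c') x) :
    False := by
  haveI : Fact (1 < n) := ⟨by omega⟩
  obtain ⟨n2, n3, n4, n5, n7, n8, n9, n13, n15⟩ := numerals (n := n) hn11 hn13 h3n
  exact core33 n2 (zsum_Z3 h3a h3b h3c hs) (isUnit_third ha h3a) (isUnit_third hb h3b)
    (isUnit_third hc h3c) (third_ne_of_nmod h3a h3a' hda) (third_ne_of_nmod h3a h3b' hdb)
    (third_ne_of_nmod h3a h3c' hdc)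
    (fun x => by simpa only [muFun_Z3 h3a h3b h3c, muFun_Z3 h3a' h3b' h3c'] using hE x)

/-- (Z3, Z1), the Z1 triple normalised as `(3y′, u′, v′)` -/
theorem caseZ3Z1 (h3n : ¬ 3 ∣ n) (hn11 : 11 ≤ n) (hn13 : n ≠ 13) {a b c a' b' c' : ℕ}
    (h3a : 3 ∣ a) (h3b : 3 ∣ b) (h3c : 3 ∣ c) (h3a' : 3 ∣ a') (h3b' : ¬ 3 ∣ b') (h3c' : ¬ 3 ∣ c')
    (hs' : 3 * n ∣ a' + b' + c') (ha' : Nat.Coprime a' n) (hb' : Nat.Coprime b' n)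
    (hda : ¬ a ≡ a' [MOD 3 * n]) (hdb : ¬ b ≡ a' [MOD 3 * n]) (hdc : ¬ c ≡ a' [MOD 3 * n])
    (hE : ∀ x : ZMod n, muFun (a, b, c) (-x) - muFun (a', b', c') (-x) = muFun (a, b, c) x - muFun (a', b', c') x)
    (hD : ∀ x : ZMod n, nuFun (a, b, c) (-x) - nuFun (a', b', c') (-x) = -(nuFun (a, b, c) x - nuFun (a', b', c') x)) :
    False := by
  haveI : Fact (1 < n) := ⟨by omega⟩
  obtain ⟨n2, n3, n4, n5, n7, n8, n9, n13, n15⟩ := numerals (n := n) hn11 hn13 h3n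
  have hbc : 3 ∣ b' + c' := by have := three_dvd hs'; omega
  refine core31 n2 n3 n5 n9 (I := ((a / 3 : ℕ) : ZMod n)) (J := ((b / 3 : ℕ) : ZMod n)) (K := ((c / 3 : ℕ) : ZMod n))
    (zsum_Z1 h3a' hs') (isUnit_third ha' h3a') (isUnit_cast hb')
    (third_ne_of_nmod h3a' h3a (fun h => hda h.symm)) (third_ne_of_nmod h3a' h3b (fun h => hdb h.symm))
    (third_ne_of_nmod h3a' h3c (fun h => hdc h.symm))
    (fun x => by simpa only [muFun_Z3 h3a h3b h3c, muFun_Z1 h3a' h3b' h3c'] using hE x) (fun x => ?_)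
  have h := hD x
  simp only [nuFun_Z3 h3a h3b h3c, nuFun_Z1 h3a' h3b' h3c', chi3_neg h3b' hbc] at h
  have h' : chi3 b' * (-(ind ((b' : ZMod n) = -x) - ind ((c' : ZMod n) = -x)))
      = chi3 b' * (ind ((b' : ZMod n) = x) - ind ((c' : ZMod n) = x)) := by linear_combination h
  exact mul_left_cancel₀ (chi3_ne_zero h3b') h'

/-- (Z1, Z1), both normalised as `(3y, u, v)` and ALIGNED: `u ≡ u′ (mod 3)` -/
theorem caseZ1Z1 (h2n : ¬ 2 ∣ n) (h3n : ¬ 3 ∣ n) (hn11 : 11 ≤ n) (hn13 : n ≠ 13) {a b c a' b' c' : ℕ}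
    (h3a : 3 ∣ a) (h3b : ¬ 3 ∣ b) (h3c : ¬ 3 ∣ c) (h3a' : 3 ∣ a') (h3b' : ¬ 3 ∣ b') (h3c' : ¬ 3 ∣ c')
    (hbb : b % 3 = b' % 3) (hs : 3 * n ∣ a + b + c) (hs' : 3 * n ∣ a' + b' + c')
    (ha : Nat.Coprime a n) (hb : Nat.Coprime b n) (hc : Nat.Coprime c n)
    (ha' : Nat.Coprime a' n) (hb' : Nat.Coprime b' n) (hc' : Nat.Coprime c' n)
    (hdb : ¬ b ≡ b' [MOD 3 * n]) (hdc : ¬ c ≡ c' [MOD 3 * n])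
    (hE : ∀ x : ZMod n, muFun (a, b, c) (-x) - muFun (a', b', c') (-x) = muFun (a, b, c) x - muFun (a', b', c') x)
    (hD : ∀ x : ZMod n, nuFun (a, b, c) (-x) - nuFun (a', b', c') (-x) = -(nuFun (a, b, c) x - nuFun (a', b', c') x)) :
    False := by
  haveI : Fact (1 < n) := ⟨by omega⟩
  obtain ⟨-, -, n4, n5, n7, -, n9, -, n15⟩ := numerals (n := n) hn11 hn13 h3n
  obtain ⟨u2, u3⟩ := units23 (n := n) h2n h3n
  have h3s := three_dvd hs
  have h3s' := three_dvd hs'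
  have hcc : c % 3 = c' % 3 := by omega
  have hbc : 3 ∣ b + c := by omega
  have hbc' : 3 ∣ b' + c' := by omega
  refine coreZZ u2 u3 n4 n5 n7 n9 n15 (zsum_Z1 h3a hs) (zsum_Z1 h3a' hs')
    (isUnit_third ha h3a) (isUnit_cast hb) (isUnit_cast hc)
    (isUnit_third ha' h3a') (isUnit_cast hb') (isUnit_cast hc')
    (ne_of_nmod h3n hbb hdb) (ne_of_nmod h3n hcc hdc)
    (fun x => by simpa only [muFun_Z1 h3a h3b h3c, muFun_Z1 h3a' h3b' h3c'] using hE x) (fun x => ?_)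
  have h := hD x
  simp only [nuFun_Z1 h3a h3b h3c, nuFun_Z1 h3a' h3b' h3c', chi3_neg h3b hbc, chi3_neg h3b' hbc',
    chi3_congr hbb] at h
  have h' : chi3 b' * dZ (b : ZMod n) (c : ZMod n) (b' : ZMod n) (c' : ZMod n) (-x)
      = chi3 b' * (-dZ (b : ZMod n) (c : ZMod n) (b' : ZMod n) (c' : ZMod n) x) := by
    unfold dZ; linear_combination h
  exact mul_left_cancel₀ (chi3_ne_zero h3b') h'

/-- (U, U) -/
theorem caseUU (h3n : ¬ 3 ∣ n) (hn11 : 11 ≤ n) (hn13 : n ≠ 13) {a b c a' b' c' : ℕ}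
    (h3a : ¬ 3 ∣ a) (h3b : ¬ 3 ∣ b) (h3c : ¬ 3 ∣ c) (h3a' : ¬ 3 ∣ a') (h3b' : ¬ 3 ∣ b') (h3c' : ¬ 3 ∣ c')
    (hs : 3 * n ∣ a + b + c) (hs' : 3 * n ∣ a' + b' + c')
    (ha : Nat.Coprime a n) (hb : Nat.Coprime b n) (hc : Nat.Coprime c n)
    (hD : ∀ u v, (u = a ∨ u = b ∨ u = c) → (v = a' ∨ v = b' ∨ v = c') → ¬ u ≡ v [MOD 3 * n])
    (hsum : chi3 a + chi3 b + chi3 c = chi3 a' + chi3 b' + chi3 c')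
    (hE : ∀ x : ZMod n, muFun (a, b, c) (-x) - muFun (a', b', c') (-x) = muFun (a, b, c) x - muFun (a', b', c') x)
    (hDD : ∀ x : ZMod n, nuFun (a, b, c) (-x) - nuFun (a', b', c') (-x) = -(nuFun (a, b, c) x - nuFun (a', b', c') x)) :
    False := by
  haveI : Fact (1 < n) := ⟨by omega⟩
  obtain ⟨n2, n3, n4, n5, n7, n8, n9, n13, n15⟩ := numerals (n := n) hn11 hn13 h3n
  have h3s := three_dvd hs
  have h3s' := three_dvd hs'
  have hab : a % 3 = b % 3 := by omega
  have hac : a % 3 = c % 3 := by omega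
  have hab' : a' % 3 = b' % 3 := by omega
  have hac' : a' % 3 = c' % 3 := by omega
  have haa : a % 3 = a' % 3 := by
    rw [← chi3_congr hab, ← chi3_congr hac, ← chi3_congr hab', ← chi3_congr hac'] at hsum
    exact mod_eq_of_chi3_eq h3a (by linarith)
  have dj : ∀ {u v : ℕ}, (u = a ∨ u = b ∨ u = c) → (v = a' ∨ v = b' ∨ v = c') → u % 3 = v % 3 →
      (v : ZMod n) ≠ (u : ZMod n) := fun hu hv h => ne_of_nmod h3n h (hD _ _ hu hv)
  refine coreUU n2 n4 n8 n13 (zsum_U hs) (isUnit_cast ha) (isUnit_cast hb) (isUnit_cast hc)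
    (dj (Or.inl rfl) (Or.inl rfl) haa) (dj (Or.inl rfl) (Or.inr (Or.inl rfl)) (by omega))
    (dj (Or.inl rfl) (Or.inr (Or.inr rfl)) (by omega)) (dj (Or.inr (Or.inl rfl)) (Or.inl rfl) (by omega))
    (dj (Or.inr (Or.inl rfl)) (Or.inr (Or.inl rfl)) (by omega)) (dj (Or.inr (Or.inl rfl)) (Or.inr (Or.inr rfl)) (by omega))
    (dj (Or.inr (Or.inr rfl)) (Or.inl rfl) (by omega)) (dj (Or.inr (Or.inr rfl)) (Or.inr (Or.inl rfl)) (by omega))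
    (dj (Or.inr (Or.inr rfl)) (Or.inr (Or.inr rfl)) (by omega))
    (fun x => by simpa only [muFun_U h3a h3b h3c, muFun_U h3a' h3b' h3c'] using hE x) (fun x => ?_)
  have h := hDD x
  simp only [nuFun_U h3a h3b h3c, nuFun_U h3a' h3b' h3c', ← chi3_congr hab, ← chi3_congr hac, ← chi3_congr haa,
    ← chi3_congr (haa.trans hab'), ← chi3_congr (haa.trans hac')] at h
  have h' : chi3 a * (nU (a : ZMod n) (b : ZMod n) (c : ZMod n) (-x)
        - nU (a' : ZMod n) (b' : ZMod n) (c' : ZMod n) (-x))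
      = chi3 a * (-(nU (a : ZMod n) (b : ZMod n) (c : ZMod n) x
        - nU (a' : ZMod n) (b' : ZMod n) (c' : ZMod n) x)) := by
    unfold nU; linear_combination h
  exact mul_left_cancel₀ (chi3_ne_zero h3a) h'

/-! ## 5. Assembly: the DECODING THEOREM at level `3n` -/

/-- both triples in 3-normal form (U, or Z1 with the 3-divisible entry first, or Z3) -/
theorem thmF_of_parity_nf (h2n : ¬ 2 ∣ n) (h3n : ¬ 3 ∣ n) (hn11 : 11 ≤ n) (hn13 : n ≠ 13) {a b c a' b' c' : ℕ}
    (hn : (¬ 3 ∣ a ∧ ¬ 3 ∣ b ∧ ¬ 3 ∣ c) ∨ (3 ∣ a ∧ ¬ 3 ∣ b ∧ ¬ 3 ∣ c) ∨ (3 ∣ a ∧ 3 ∣ b ∧ 3 ∣ c))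
    (hn' : (¬ 3 ∣ a' ∧ ¬ 3 ∣ b' ∧ ¬ 3 ∣ c') ∨ (3 ∣ a' ∧ ¬ 3 ∣ b' ∧ ¬ 3 ∣ c') ∨ (3 ∣ a' ∧ 3 ∣ b' ∧ 3 ∣ c'))
    (hs : 3 * n ∣ a + b + c) (hs' : 3 * n ∣ a' + b' + c')
    (ha : Nat.Coprime a n) (hb : Nat.Coprime b n) (hc : Nat.Coprime c n)
    (ha' : Nat.Coprime a' n) (hb' : Nat.Coprime b' n) (hc' : Nat.Coprime c' n)
    (hD : ∀ u v, (u = a ∨ u = b ∨ u = c) → (v = a' ∨ v = b' ∨ v = c') → ¬ u ≡ v [MOD 3 * n])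
    (hP : Parity n (a, b, c) (a', b', c')) : False := by
  have h3s := three_dvd hs
  have h3s' := three_dvd hs'
  have hE := hP.1
  have hDD := hP.2.1
  have hsum : chi3 a + chi3 b + chi3 c = chi3 a' + chi3 b' + chi3 c' := hP.2.2
  rcases hn with ⟨h3a, h3b, h3c⟩ | ⟨h3a, h3b, h3c⟩ | ⟨h3a, h3b, h3c⟩ <;>
    rcases hn' with ⟨h3a', h3b', h3c'⟩ | ⟨h3a', h3b', h3c'⟩ | ⟨h3a', h3b', h3c'⟩
  · exact caseUU h3n hn11 hn13 h3a h3b h3c h3a' h3b' h3c' hs hs' ha hb hc hD hsum hE hDD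
  · exact sum3_U h3s h3a h3b h3c (hsum.trans (sum3_Z h3s' h3a'))
  · exact sum3_U h3s h3a h3b h3c (hsum.trans (sum3_Z h3s' h3a'))
  · exact sum3_U h3s' h3a' h3b' h3c' (hsum.symm.trans (sum3_Z h3s h3a))
  · by_cases hbb : b % 3 = b' % 3
    · exact caseZ1Z1 h2n h3n hn11 hn13 h3a h3b h3c h3a' h3b' h3c' hbb hs hs' ha hb hc ha' hb' hc'
        (hD b b' (Or.inr (Or.inl rfl)) (Or.inr (Or.inl rfl))) (hD c c' (Or.inr (Or.inr rfl)) (Or.inr (Or.inr rfl))) hE hDD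
    · have hbc : b % 3 = c' % 3 := by omega
      have hs2 : 3 * n ∣ a' + c' + b' := by rwa [Nat.add_right_comm]
      have hP2 : Parity n (a, b, c) (a', c', b') := parity_swap_right (parity_rot_right hP)
      exact caseZ1Z1 h2n h3n hn11 hn13 h3a h3b h3c h3a' h3c' h3b' hbc hs hs2 ha hb hc ha' hc' hb'
        (hD b c' (Or.inr (Or.inl rfl)) (Or.inr (Or.inr rfl))) (hD c b' (Or.inr (Or.inr rfl)) (Or.inr (Or.inl rfl)))
        hP2.1 hP2.2.1
  · have hP2 := parity_symm hP
    exact caseZ3Z1 h3n hn11 hn13 h3a' h3b' h3c' h3a h3b h3c hs ha hb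
      (fun h => hD a a' (Or.inl rfl) (Or.inl rfl) h.symm) (fun h => hD a b' (Or.inl rfl) (Or.inr (Or.inl rfl)) h.symm)
      (fun h => hD a c' (Or.inl rfl) (Or.inr (Or.inr rfl)) h.symm) hP2.1 hP2.2.1
  · exact sum3_U h3s' h3a' h3b' h3c' (hsum.symm.trans (sum3_Z h3s h3a))
  · exact caseZ3Z1 h3n hn11 hn13 h3a h3b h3c h3a' h3b' h3c' hs' ha' hb'
      (hD a a' (Or.inl rfl) (Or.inl rfl)) (hD b a' (Or.inr (Or.inl rfl)) (Or.inl rfl)) (hD c a' (Or.inr (Or.inr rfl)) (Or.inl rfl))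
      hE hDD
  · exact caseZ3Z3 h3n hn11 hn13 h3a h3b h3c h3a' h3b' h3c' hs ha hb hc
      (hD a a' (Or.inl rfl) (Or.inl rfl)) (hD a b' (Or.inl rfl) (Or.inr (Or.inl rfl))) (hD a c' (Or.inl rfl) (Or.inr (Or.inr rfl)))
      hE

/-- the first triple in 3-normal form -/
theorem thmF_of_parity_nf1 (h2n : ¬ 2 ∣ n) (h3n : ¬ 3 ∣ n) (hn11 : 11 ≤ n) (hn13 : n ≠ 13) {a b c a' b' c' : ℕ}
    (hn : (¬ 3 ∣ a ∧ ¬ 3 ∣ b ∧ ¬ 3 ∣ c) ∨ (3 ∣ a ∧ ¬ 3 ∣ b ∧ ¬ 3 ∣ c) ∨ (3 ∣ a ∧ 3 ∣ b ∧ 3 ∣ c))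
    (hs : 3 * n ∣ a + b + c) (hs' : 3 * n ∣ a' + b' + c')
    (ha : Nat.Coprime a n) (hb : Nat.Coprime b n) (hc : Nat.Coprime c n)
    (ha' : Nat.Coprime a' n) (hb' : Nat.Coprime b' n) (hc' : Nat.Coprime c' n)
    (hD : ∀ u v, (u = a ∨ u = b ∨ u = c) → (v = a' ∨ v = b' ∨ v = c') → ¬ u ≡ v [MOD 3 * n])
    (hP : Parity n (a, b, c) (a', b', c')) : False := by
  have h3s' := three_dvd hs'
  by_cases h3a' : 3 ∣ a' <;> by_cases h3b' : 3 ∣ b' <;> by_cases h3c' : 3 ∣ c'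
  · exact thmF_of_parity_nf h2n h3n hn11 hn13 hn (Or.inr (Or.inr ⟨h3a', h3b', h3c'⟩)) hs hs' ha hb hc ha' hb' hc' hD hP
  · omega
  · omega
  · exact thmF_of_parity_nf h2n h3n hn11 hn13 hn (Or.inr (Or.inl ⟨h3a', h3b', h3c'⟩)) hs hs' ha hb hc ha' hb' hc' hD hP
  · omega
  · have hs2 : 3 * n ∣ b' + a' + c' := by rwa [Nat.add_comm b' a']
    exact thmF_of_parity_nf h2n h3n hn11 hn13 hn (Or.inr (Or.inl ⟨h3b', h3a', h3c'⟩)) hs hs2 ha hb hc hb' ha' hc'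
      (fun u v hu hv => hD u v hu (by tauto)) (parity_swap_right hP)
  · have hs2 : 3 * n ∣ c' + a' + b' := by rwa [show c' + a' + b' = a' + b' + c' by ring]
    exact thmF_of_parity_nf h2n h3n hn11 hn13 hn (Or.inr (Or.inl ⟨h3c', h3a', h3b'⟩)) hs hs2 ha hb hc hc' ha' hb'
      (fun u v hu hv => hD u v hu (by tauto)) (parity_rot_right hP)
  · exact thmF_of_parity_nf h2n h3n hn11 hn13 hn (Or.inl ⟨h3a', h3b', h3c'⟩) hs hs' ha hb hc ha' hb' hc' hD hP

/-- the decoding theorem for ODD `n` (the substantive case; for even `n` the hypotheses are contradictory, `thmF_of_parity`) -/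
theorem thmF_of_parity_odd (h2n : ¬ 2 ∣ n) (h3n : ¬ 3 ∣ n) (hn11 : 11 ≤ n) (hn13 : n ≠ 13) {a b c a' b' c' : ℕ}
    (hs : 3 * n ∣ a + b + c) (hs' : 3 * n ∣ a' + b' + c')
    (ha : Nat.Coprime a n) (hb : Nat.Coprime b n) (hc : Nat.Coprime c n)
    (ha' : Nat.Coprime a' n) (hb' : Nat.Coprime b' n) (hc' : Nat.Coprime c' n)
    (hD : ∀ u v, (u = a ∨ u = b ∨ u = c) → (v = a' ∨ v = b' ∨ v = c') → ¬ u ≡ v [MOD 3 * n])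
    (hP : Parity n (a, b, c) (a', b', c')) : False := by
  have h3s := three_dvd hs
  by_cases h3a : 3 ∣ a <;> by_cases h3b : 3 ∣ b <;> by_cases h3c : 3 ∣ c
  · exact thmF_of_parity_nf1 h2n h3n hn11 hn13 (Or.inr (Or.inr ⟨h3a, h3b, h3c⟩)) hs hs' ha hb hc ha' hb' hc' hD hP
  · omega
  · omega
  · exact thmF_of_parity_nf1 h2n h3n hn11 hn13 (Or.inr (Or.inl ⟨h3a, h3b, h3c⟩)) hs hs' ha hb hc ha' hb' hc' hD hP
  · omega
  · have hs2 : 3 * n ∣ b + a + c := by rwa [Nat.add_comm b a]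
    exact thmF_of_parity_nf1 h2n h3n hn11 hn13 (Or.inr (Or.inl ⟨h3b, h3a, h3c⟩)) hs2 hs' hb ha hc ha' hb' hc'
      (fun u v hu hv => hD u v (by tauto) hv) (parity_swap_left hP)
  · have hs2 : 3 * n ∣ c + a + b := by rwa [show c + a + b = a + b + c by ring]
    exact thmF_of_parity_nf1 h2n h3n hn11 hn13 (Or.inr (Or.inl ⟨h3c, h3a, h3b⟩)) hs2 hs' hc ha hb ha' hb' hc'
      (fun u v hu hv => hD u v (by tauto) hv) (parity_rot_left hP)
  · exact thmF_of_parity_nf1 h2n h3n hn11 hn13 (Or.inl ⟨h3a, h3b, h3c⟩) hs hs' ha hb hc ha' hb' hc' hD hP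

/-- an entry prime to an EVEN `n` is odd -/
lemma two_not_dvd {y : ℕ} (h2n : 2 ∣ n) (hy : Nat.Coprime y n) : ¬ 2 ∣ y := fun h => by
  have h1 := Nat.dvd_gcd h h2n
  rw [Nat.Coprime.gcd_eq_one hy] at h1
  omega

/-- **THE DECODING THEOREM at level `3n` for EVERY `n ≥ 11` with `3 ∤ n`, `n ≠ 13` (ring form of THEOREM F\*(3p); no `H0`, no CM types).**
Two zero-sum triples mod `3n` with entries prime to `n`, DISJOINT mod `3n`, never satisfy PARITY(3n).  (For even `n` three entries prime
to `n` are odd and cannot sum to a multiple of `3n`, so the content is the odd case `thmF_of_parity_odd`.) -/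
theorem thmF_of_parity (h3n : ¬ 3 ∣ n) (hn11 : 11 ≤ n) (hn13 : n ≠ 13) {a b c a' b' c' : ℕ}
    (hs : 3 * n ∣ a + b + c) (hs' : 3 * n ∣ a' + b' + c')
    (ha : Nat.Coprime a n) (hb : Nat.Coprime b n) (hc : Nat.Coprime c n)
    (ha' : Nat.Coprime a' n) (hb' : Nat.Coprime b' n) (hc' : Nat.Coprime c' n)
    (hD : ∀ u v, (u = a ∨ u = b ∨ u = c) → (v = a' ∨ v = b' ∨ v = c') → ¬ u ≡ v [MOD 3 * n])
    (hP : Parity n (a, b, c) (a', b', c')) : False := by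
  by_cases h2n : 2 ∣ n
  · have h2s : 2 ∣ a + b + c := dvd_trans h2n (p_dvd hs)
    have := two_not_dvd h2n ha
    have := two_not_dvd h2n hb
    have := two_not_dvd h2n hc
    omega
  · exact thmF_of_parity_odd h2n h3n hn11 hn13 hs hs' ha hb hc ha' hb' hc' hD hP

/-- the contrapositive packaging: under PARITY(3n) two such triples SHARE an entry mod `3n` -/
theorem share_of_parity (h3n : ¬ 3 ∣ n) (hn11 : 11 ≤ n) (hn13 : n ≠ 13) {a b c a' b' c' : ℕ}
    (hs : 3 * n ∣ a + b + c) (hs' : 3 * n ∣ a' + b' + c')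
    (ha : Nat.Coprime a n) (hb : Nat.Coprime b n) (hc : Nat.Coprime c n)
    (ha' : Nat.Coprime a' n) (hb' : Nat.Coprime b' n) (hc' : Nat.Coprime c' n)
    (hP : Parity n (a, b, c) (a', b', c')) :
    ∃ u v, (u = a ∨ u = b ∨ u = c) ∧ (v = a' ∨ v = b' ∨ v = c') ∧ u ≡ v [MOD 3 * n] := by
  by_contra h
  exact thmF_of_parity h3n hn11 hn13 hs hs' ha hb hc ha' hb' hc' (fun u v hu hv huv => h ⟨u, v, hu, hv, huv⟩) hP

end Level

/-! ## 6. Consistency: THEOREM F\*(3p) of `Decoding` re-derived from the ring theorem (PARITY(3p) from `H0`, HF-G31c/e + `NuOddSharp`) -/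

section Prime

variable {p : ℕ}

/-- PARITY(3p) for a same-CM-type pair at a prime level (from `H0`: `mu_even`, `nu_odd′`, `nu_sum_eq′`) -/
theorem parity_of_sameType (h0 : H0) (hp : p.Prime) (hp11 : 11 ≤ p) (hp13 : p ≠ 13) {a b c a' b' c' : ℕ}
    (hs : 3 * p ∣ a + b + c) (hs' : 3 * p ∣ a' + b' + c')
    (ha : Nat.Coprime a p) (hb : Nat.Coprime b p) (hc : Nat.Coprime c p)
    (ha' : Nat.Coprime a' p) (hb' : Nat.Coprime b' p) (hc' : Nat.Coprime c' p)
    (hT : SameType (3 * p) (a, b, c) (a', b', c')) : Parity p (a, b, c) (a', b', c') :=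
  have hp3 : p ≠ 3 := by omega
  ⟨mu_even h0 hp hp3 hs hs' ha hb hc ha' hb' hc' hT, nu_odd' h0 hp hp11 hp13 hs hs' ha hb hc ha' hb' hc' hT,
    nu_sum_eq' h0 hp hp11 hp13 hs hs' ha hb hc ha' hb' hc' hT⟩

-- `thmFstar'` (source l.637–647, `Decoding.thmFstar` again through `thmF_of_parity`): DELETED — by design a verbatim
-- restatement of the landed `HodgeFermat.KRFree.Decoding.thmFstar` (gate dedup); the consistency content is `parity_of_sameType`.

end Prime

end HodgeFermat.KRFree.DecodingRing
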